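import Summits.BirchSwinnertonDyer.BirchSwinnertonDyer.Theorems.ThetaPartnerAtTwoSignedKatoUpToAtTwoPlusHondaWithLog
import Summits.BirchSwinnertonDyer.BirchSwinnertonDyer.Theorems.ThetaPartnerAtTwoSignedKatoUpToAtTwoHondaLogCharSum
import HarnessLib

/-!
# Route `ThetaPartnerAtTwo` (TP2), crux K3 `SignedKatoDivisibilityUpToAtTwo` (stmt-BirchSwinnertonDyer-20308 / K3P′ 25631), line
# `colemanrat` v12 — (R3) ON THE CRUX'S OWN OBJECTS: the character sums of the logarithms of the Galois conjugates of the plus Honda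
# point `d_n ∈ E(ℚ_{2,n})` (Kobayashi Prop. 8.26 at `p = 2`, un-normalised) for the DISPLAYED Honda system of `plusHondaSystemTwo_padic_withLog`

Lead prover `bsd-wall-tp2-p2x` g6 (cell `bsd-wall`). HONEST FRAMING: theorems only (no definition, no named fact, no instance, no `sorry`);
closes no item; K3 / K3P′ are NOT settled and BSD is NOT proved by any of this.

## What

`SignedKatoOffTwo.HondaLog.sum_mul_ptLogΩ_act_plusPoint_eq` (p623941) computes `Σ_a ψ(a)·Λ(act τ_a D)` for an ABSTRACT coordinatewise Galois action
`act` on the `Ω`-points of the `2`-adic model and `D = 3•(c + act σ c) − 2•c₁`. Here it is read on the crux's currency: the local points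
`localPoints W ℚ_[2] = E(ℚ̄₂)` with their Galois action `τ • P`, the model transport `toLoc hV : E_Ω ≃+ E(ℚ̄₂)` of the K3/K4 construction
(`act τ := toLoc⁻¹ ∘ (τ • ·) ∘ toLoc`, coordinatewise by `act_some`/`act_zero`), and the DISPLAYED plus Honda system
`d_n = 3•(c_{n+2} + σ_{n+2}•c_{n+2}) − 2•c_1` with `Λ(toLoc⁻¹ c_m) = ℓ_m` (`SignedEC.PlusLayer.plusHondaSystemTwo_padic_withLog`, p625694):

* `sum_mul_ptLogΩ_smul_plusHondaPoint_eq`: for every `n`, every family `τ_a ∈ Γ_{ℚ₂}` with `τ_a ζ_{2^{n+2}} = ζ_{2^{n+2}}^a` on units `a`, and every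
  PRIMITIVE Dirichlet character `ψ` modulo `2^{n+2}`: `Σ_a ψ(a) · Λ(toLoc⁻¹(τ_a • d_n)) = 3(1 + ψ(−1))·τ(ψ, ζ_{2^{n+2}})`;
* the Honda system itself (display ∧ (L)(TR)(GEN)(NONDIV), resp. its transport to `ℚ_v`) is `plusHondaSystemTwo_padic_withLog` /
  `plusHondaSystemTwo_adicCompletion_withLog` (p625694 / p625962), whose display clause is literally the hypothesis `hcΩ` here.
This is the log half of «`ψ(P_{n,d_n}(z)) = (Σψ log)(Σψ̄ exp*)`» (`HondaLog.sum_mul_trace_smul_mul_eq`) for the Honda system the crux's stub may choose.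

References: [Kobayashi2003] S. Kobayashi, Invent. Math. 152 (2003), §8.4 (Lemma 8.9), Prop. 8.25–8.26 (pp. 24–25).
-/

set_option autoImplicit false
-- the Theorems namespace of this sub repeats the summit name by design (D-0017 nested layout)
set_option linter.dupNamespace false

noncomputable section

open scoped Classical IntermediateField Topology NNReal NumberField

namespace Summit.BirchSwinnertonDyer.BirchSwinnertonDyer.Theorems.SignedEC.PlusLayer

open Field WeierstrassCurve NumberField IsDedekindDomain Literature.NumberTheory.EllipticCurves
  Literature.NumberTheory.GaloisRepresentations
  Literature.NumberTheory.EllipticCurves.ZpExtension Literature.NumberTheory.EllipticCurves.Kobayashi2003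
  Literature.NumberTheory.EllipticCurves.FormalGroupChart Literature.NumberTheory.EllipticCurves.Rank1Residual
  Summit.BirchSwinnertonDyer.Rank1Residual.Additive Summit.BirchSwinnertonDyer.Rank1Residual.Additive.PadicCyclotomicTower
  Summit.BirchSwinnertonDyer.Rank1Residual.Additive.BallEval
  Summit.BirchSwinnertonDyer.BirchSwinnertonDyer.Theorems.SignedKatoOffTwo.LocalTwo
  Summit.BirchSwinnertonDyer.BirchSwinnertonDyer.Theorems.SignedKatoOffTwo.HondaLog

/-- **Kobayashi Prop. 8.26 at `2` for the displayed plus Honda point.** For `W/ℚ` globally minimal, tower points `c_m`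
with `toLoc⁻¹ c_m ∈ L(m) ∩ E₁`, `Λ(toLoc⁻¹ c_m) = ℓ_m`, inverters `σ_m` and `d_n = 3•(c_{n+2} + σ_{n+2}•c_{n+2}) − 2•c_1`; for every `n`,
every `τ : ℤ/2^{n+2} → Γ_{ℚ₂}` with `τ_a ζ_{2^{n+2}} = ζ_{2^{n+2}}^a` for units `a`, and every primitive `ψ` mod `2^{n+2}`:
`Σ_a ψ(a) · Λ(toLoc⁻¹(τ_a • d_n)) = 3(1 + ψ(−1)) · Σ_a ψ(a) ζ_{2^{n+2}}^a`. [cite: Kobayashi2003, Prop. 8.26 (p. 25)] -/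
theorem sum_mul_ptLogΩ_smul_plusHondaPoint_eq (W : WeierstrassCurve ℚ) [W.IsElliptic] [W.IsGloballyMinimal]
    {c : ℕ → localPoints W ℚ_[2]} {σ : ℕ → Field.absoluteGaloisGroup ℚ_[2]} {d : ℕ → localPoints W ℚ_[2]}
    (hcΩ : haveI := isIntegral_genFib_baseChange 2 ((integralModelInt W).map (Int.castRingHom ℤ_[2]))
        ∀ m, (toLoc ((genFibΩ_eq_baseChange ((integralModelInt W).map (Int.castRingHom ℤ_[2]))).trans
              (baseChange_twoAdicModel W))).symm (c m) ∈
            subfieldPoints (genFibΩ 2 ((integralModelInt W).map (Int.castRingHom ℤ_[2]))) (layer 2 m).toSubfield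
              coeffs_mem_layer ∧
          (toLoc ((genFibΩ_eq_baseChange ((integralModelInt W).map (Int.castRingHom ℤ_[2]))).trans
              (baseChange_twoAdicModel W))).symm (c m) ∈
            kernel (Valued.v (R := PadicAlgCl 2)) (genFibΩ 2 ((integralModelInt W).map (Int.castRingHom ℤ_[2]))) ∧
          ptLogΩ 2 ((integralModelInt W).map (Int.castRingHom ℤ_[2]))
            ((toLoc ((genFibΩ_eq_baseChange ((integralModelInt W).map (Int.castRingHom ℤ_[2]))).trans
              (baseChange_twoAdicModel W))).symm (c m)) = ell 2 m)
    (hσ : ∀ m, 1 ≤ m → σ m • zeta 2 m = (zeta 2 m)⁻¹)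
    (hd : ∀ n, d n = 3 • (c (n + 2) + σ (n + 2) • c (n + 2)) - 2 • c 1)
    (n : ℕ) [NeZero (2 ^ (n + 2))] (τ : ZMod (2 ^ (n + 2)) → Field.absoluteGaloisGroup ℚ_[2])
    (hτ : ∀ a : ZMod (2 ^ (n + 2)), IsUnit a → τ a • zeta 2 (n + 2) = zeta 2 (n + 2) ^ a.val)
    (ψ : DirichletCharacter (PadicAlgCl 2) (2 ^ (n + 2))) (hψ : ψ.IsPrimitive) :
    haveI := isIntegral_genFib_baseChange 2 ((integralModelInt W).map (Int.castRingHom ℤ_[2]))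
    ∑ a : ZMod (2 ^ (n + 2)), ψ a *
        ptLogΩ 2 ((integralModelInt W).map (Int.castRingHom ℤ_[2]))
          ((toLoc ((genFibΩ_eq_baseChange ((integralModelInt W).map (Int.castRingHom ℤ_[2]))).trans
            (baseChange_twoAdicModel W))).symm (τ a • d n)) =
      3 * (1 + ψ (-1)) * gaussSum ψ (AddChar.zmodChar (2 ^ (n + 2)) (zeta_pow_prime_pow_self (p := 2) (n + 2))) := by
  set M : WeierstrassCurve ℤ_[2] := (integralModelInt W).map (Int.castRingHom ℤ_[2]) with hM
  haveI := isElliptic_coe_twoAdicModel W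
  haveI hintΩ := isIntegral_genFib_baseChange 2 M
  set hV := (genFibΩ_eq_baseChange M).trans (baseChange_twoAdicModel W) with hVdef
  set act : Field.absoluteGaloisGroup ℚ_[2] → (genFibΩ 2 M).toAffine.Point → (genFibΩ 2 M).toAffine.Point :=
    fun ρ P ↦ (toLoc hV).symm (ρ • toLoc hV P) with hact
  obtain ⟨hcL, hck, hcℓ⟩ := hcΩ (n + 2)
  obtain ⟨hc₁L, hc₁k, hc₁ℓ⟩ := hcΩ 1
  -- the transported point is `act (τ a) (3•(C + act σ C) − 2•C₁)`
  have hD : (toLoc hV).symm (d n) =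
      (3 : ℕ) • ((toLoc hV).symm (c (n + 2)) + act (σ (n + 2)) ((toLoc hV).symm (c (n + 2)))) -
        (2 : ℕ) • (toLoc hV).symm (c 1) := by
    rw [hd n, map_sub, map_nsmul, map_nsmul, map_add, hact]
    simp only [AddEquiv.apply_symm_apply]
  have hpt : ∀ a : ZMod (2 ^ (n + 2)), (toLoc hV).symm (τ a • d n) =
      act (τ a) ((3 : ℕ) • ((toLoc hV).symm (c (n + 2)) + act (σ (n + 2)) ((toLoc hV).symm (c (n + 2)))) -
        (2 : ℕ) • (toLoc hV).symm (c 1)) := by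
    intro a
    rw [← hD, hact]
    simp only [AddEquiv.apply_symm_apply]
  simp only [hpt]
  exact sum_mul_ptLogΩ_act_plusPoint_eq act (act_zero hV) (act_some hV) (by omega : 2 ≤ n + 2) (hσ (n + 2) (by omega)) τ hτ
    hcL hck hcℓ hc₁L hc₁k hc₁ℓ ψ hψ

end Summit.BirchSwinnertonDyer.BirchSwinnertonDyer.Theorems.SignedEC.PlusLayer

end
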